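import Mathlib
import HarnessLib

/-!
# Crux `HypACumulant`, line `gnv` — POINTWISE limits of LOCALLY BOUNDED holomorphic sequences are holomorphic
# (the Vitali/Montel step, via Cauchy's estimate and equi-Lipschitz control)

Route `route-HubbardSuperconductivity-ComplexGFFStiffness`, cruxes stmt-HubbardSuperconductivity-19154 /
-19155, shared research statement `OnePointLipschitz`, census (C3d′) (memo §8).  To obtain the holomorphy of
the Taylor coefficients of a family of functionals from POINTWISE holomorphy in the parameter, per-parameter
smoothness in the field and LOCALLY UNIFORM norm bounds only (no joint smoothness, so that products and
fluctuation integrals are covered by the tree's zeroth-order estimates), difference quotients in the field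
are pointwise limits of holomorphic functions that are merely locally bounded; this file proves that such
limits are holomorphic:

* **`differentiableOn_of_tendsto_locally_bounded`** — `F n` holomorphic on an open `U ⊆ ℂ` (eventually),
  locally uniformly bounded (eventually), `F n z → f z` for every `z ∈ U`: then `f` is holomorphic on `U`
  (Cauchy's estimate makes the `F n` equi-Lipschitz on small discs, so pointwise convergence is locally
  uniform; `TendstoLocallyUniformlyOn.differentiableOn`).

Pure complex analysis; all proved, no `sorry`.

## References
* S. Adams, S. Buchholz, R. Kotecký, S. Müller, arXiv:1910.13564, Ch. 10–11 [AdamsBuchholzKoteckyMuller2019].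
-/

noncomputable section

-- `Summit.<Summit>.<Problem>`: single-conjunct summit, the duplicate component is mandated (D-0017).
set_option linter.dupNamespace false

namespace Summit.HubbardSuperconductivity.HubbardSuperconductivity.Theorems.ComplexGFF

open Metric Set Filter Topology

/-- **Pointwise limits of locally bounded holomorphic sequences are holomorphic.** -/
theorem differentiableOn_of_tendsto_locally_bounded {U : Set ℂ} (hU : IsOpen U) {F : ℕ → ℂ → ℂ} {f : ℂ → ℂ}
    (hF : ∀ᶠ n in atTop, DifferentiableOn ℂ (F n) U)
    (hbd : ∀ z ∈ U, ∃ r > 0, ∃ M : ℝ, closedBall z r ⊆ U ∧ ∀ᶠ n in atTop, ∀ w ∈ closedBall z r, ‖F n w‖ ≤ M)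
    (hlim : ∀ z ∈ U, Tendsto (fun n => F n z) atTop (𝓝 (f z))) :
    DifferentiableOn ℂ f U := by
  have hconv : TendstoLocallyUniformlyOn F f atTop U := by
    rw [Metric.tendstoLocallyUniformlyOn_iff]
    intro ε hε x hx
    obtain ⟨r, hr, M, hsub, hM⟩ := hbd x hx
    have hM0 : ∀ᶠ n : ℕ in atTop, (0 : ℝ) ≤ M := by
      filter_upwards [hM] with n hn
      exact le_trans (norm_nonneg _) (hn x (mem_closedBall_self hr.le))
    -- the equi-Lipschitz constant on the half disc
    set L : ℝ := M / (r / 2) with hL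
    have hlip : ∀ᶠ n : ℕ in atTop, ∀ y ∈ ball x (r / 2), ∀ z ∈ ball x (r / 2), ‖F n y - F n z‖ ≤ L * ‖y - z‖ := by
      filter_upwards [hF, hM] with n hFn hMn y hy z hz
      have hderiv : ∀ w ∈ ball x (r / 2), ‖deriv (F n) w‖ ≤ L := by
        intro w hw
        have hsubw : closedBall w (r / 2) ⊆ closedBall x r := by
          intro a ha
          rw [mem_closedBall] at ha ⊢
          rw [mem_ball] at hw
          linarith [dist_triangle a w x]
        have hdc : DiffContOnCl ℂ (F n) (ball w (r / 2)) := by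
          refine DifferentiableOn.diffContOnCl ?_
          rw [closure_ball w (by linarith : r / 2 ≠ 0)]
          exact hFn.mono (hsubw.trans hsub)
        exact Complex.norm_deriv_le_of_forall_mem_sphere_norm_le (by linarith) hdc
          (fun a ha => hMn a (hsubw (sphere_subset_closedBall ha)))
      have hdiff : ∀ w ∈ ball x (r / 2), DifferentiableAt ℂ (F n) w := fun w hw =>
        hFn.differentiableAt (hU.mem_nhds (hsub (ball_subset_closedBall
          (mem_ball.mpr (lt_of_lt_of_le (mem_ball.mp hw) (by linarith))))))
      exact (convex_ball x (r / 2)).norm_image_sub_le_of_norm_deriv_le hdiff hderiv hz hy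
    -- the limit inherits the Lipschitz bound
    have hlipf : ∀ y ∈ ball x (r / 2), ‖f y - f x‖ ≤ L * ‖y - x‖ := by
      intro y hy
      have hxx : x ∈ ball x (r / 2) := mem_ball_self (by linarith)
      have ht : Tendsto (fun n => ‖F n y - F n x‖) atTop (𝓝 ‖f y - f x‖) :=
        ((hlim y (hsub (ball_subset_closedBall (mem_ball.mpr (lt_of_lt_of_le (mem_ball.mp hy) (by linarith)))))).sub
          (hlim x hx)).norm
      exact le_of_tendsto ht (by filter_upwards [hlip] with n hn; exact hn y hy x hxx)
    -- choose the small ball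
    have hLnn : ∀ᶠ n : ℕ in atTop, (0 : ℝ) ≤ L := by
      filter_upwards [hM0] with n hn; exact div_nonneg hn (by linarith)
    obtain ⟨δ, hδ, hδr, hδL⟩ : ∃ δ : ℝ, 0 < δ ∧ δ ≤ r / 2 ∧ L * δ ≤ ε / 3 := by
      by_cases hL0 : L ≤ 0
      · exact ⟨r / 2, by linarith, le_rfl, by nlinarith⟩
      · push Not at hL0
        refine ⟨min (r / 2) (ε / 3 / L), lt_min (by linarith) (by positivity), min_le_left _ _, ?_⟩
        calc L * min (r / 2) (ε / 3 / L) ≤ L * (ε / 3 / L) := mul_le_mul_of_nonneg_left (min_le_right _ _) hL0.le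
          _ = ε / 3 := by field_simp
    refine ⟨ball x δ, mem_nhdsWithin_of_mem_nhds (ball_mem_nhds x hδ), ?_⟩
    have hcenter : ∀ᶠ n : ℕ in atTop, dist (F n x) (f x) < ε / 3 :=
      (hlim x hx) (ball_mem_nhds _ (by linarith))
    filter_upwards [hlip, hcenter, hLnn] with n hn hcn hL0 y hy
    have hy' : y ∈ ball x (r / 2) := ball_subset_ball hδr hy
    have hxx : x ∈ ball x (r / 2) := mem_ball_self (by linarith)
    have hyx : ‖y - x‖ < δ := by rw [← dist_eq_norm]; exact mem_ball.mp hy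
    have h1 : ‖F n y - F n x‖ ≤ ε / 3 := le_trans (hn y hy' x hxx) (le_trans (mul_le_mul_of_nonneg_left hyx.le hL0) hδL)
    have h2 : ‖f y - f x‖ ≤ ε / 3 := le_trans (hlipf y hy') (le_trans (mul_le_mul_of_nonneg_left hyx.le hL0) hδL)
    have h3 : ‖F n x - f x‖ < ε / 3 := by rwa [← dist_eq_norm]
    rw [dist_eq_norm]
    have ha : ‖(f y - f x) - (F n y - F n x) - (F n x - f x)‖ ≤ ‖(f y - f x) - (F n y - F n x)‖ + ‖F n x - f x‖ :=
      norm_sub_le _ _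
    have hb : ‖(f y - f x) - (F n y - F n x)‖ ≤ ‖f y - f x‖ + ‖F n y - F n x‖ := norm_sub_le _ _
    calc ‖f y - F n y‖ = ‖(f y - f x) - (F n y - F n x) - (F n x - f x)‖ := by congr 1; ring
      _ ≤ ‖f y - f x‖ + ‖F n y - F n x‖ + ‖F n x - f x‖ := by linarith
      _ < ε := by linarith
  exact hconv.differentiableOn hF hU

end Summit.HubbardSuperconductivity.HubbardSuperconductivity.Theorems.ComplexGFF

end
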